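import Summits.QuantumFields.YangMills.Theorems.UnitScaleTiltFluctuationComparisonRegPrGlobalSlackKernelLegCfgFineScales
import Summits.QuantumFields.YangMills.Theorems.UnitScaleTiltProp7FibreLevelSupRowsT3
import Summits.QuantumFields.YangMills.Theorems.UnitScaleTiltProp8IterPlaqSmallAllL
import HarnessLib

/-!
# `UnitScaleTiltFluctuationComparisonRegPrGlobalSlackKernelLegCfgFineScalesLocal` — (Lip♮) FOR THE NATURAL CHART MAPS FROM GAUGE-INVARIANT DATA: the `L^j`-Lipschitz bound of the
# (27) loop variables of the `j`-fold averages of two close fine fields, read from a PLAQUETTE bound, the bondwise sup distance and one number — the local twin of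
# `…KernelLegCfgFineScales` §3 (crux `FluctuationComparisonRegPrIntL`, stmt-QuantumFields-20520, skeleton v5kD, STUB 3⁗χ; cell `pub/ym-inputs`, seat ym-inputs-p12 gen 4 =
# INPUT-LIST I-11 row `CfgDistCauchyΦ`; count-neutral helper, registry untouched)

WHY.  `…KernelLegCfgFineScales` (same seat, gen 3) showed that the I-11 row `CfgDistCauchyΦ` follows at every chart level from a fine comparison of order `b` pushed through chart
maps that are `L^j`-LIPSCHITZ in the bondwise sup distance of the two fine backgrounds (display (Lip♮), [Balaban1985Averaging] Prop. 6 (164) shape), and met (Lip♮) for the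
natural chart maps `Φ♮_j = (27) ∘ Ū^{(j)}` in §3 there — but through the every-`L` two-field averaging theorem in a GLOBAL flat gauge (`‖U₂,b − 1‖ ≤ δ` on every finest bond,
`EMLIterUniformAllL.norm_iter_sub_iter_sub_iterLin_le_uniform_allL`), which on a torus is a statement about small zero-modes, not about the fields the row reads.  The
local-gauge lineage of the sibling crux K1 has since DISCHARGED the gauge datum: `Prop7FibreLevelSup.norm_pertVar_iter_le_of_gauge` (level ratio from a local `η`-flat gauge
on the two `j`-blocks), `Prop7FibreLevelSupLocalGauge.norm_pertVar_iter_le_of_plaqBound` (that gauge SUPPLIED by the lattice non-abelian Poincaré lemma from the plaquette bound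
`dist1(U₀(∂p)) ≤ δ`, `η = (d−1)·2L^j·δ`) and `Prop7FibreLevelSupRowsT3.norm_pertVar_iter_le_of_plaqBound_T3` (T³ ∕ `SU(2)`: the four smallness rows from ONE number
`2·10¹⁴·L·(4L^j(ρ + 4L^jδ)) ≤ 1`).  This file composes them with the (27) Lipschitz word `…GlobalSlackLegCfgLipschitzT3.norm_B27T_su_sub_le(_canonLegDist)` and reads the two
log-disc rows of that word from plaquette smallness OF THE AVERAGES (`B10Eq27TorusAxialLog.norm_holT_contourT_sub_one_le`; `IterPlaqSmallAllL.plaqSmall_iter_T3_allL`), so that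
(Lip♮) for `Φ♮_j` holds leg by leg from GAUGE-INVARIANT data on the two fine fields only: both plaquette-regular, `ρ`-close bondwise, one number, and the leg inside print's
regime `d(c)·α_j ≤ ρ′ < 1` ([Balaban1985UV3] p.263: (27) is evaluated on `□₁` only — the cut-off the natural family `B♮` of `…GlobalSlackLegCfgDistNaturalT3` carries).

WHAT THIS FILE PROVES (def-free; every hypothesis INLINE; `Ū^{(j)} = Averaging.iter (blockAvg expMeanLogSU) j U`, the tree's `exp[mean log]` average of record).
* §1 **`norm_iter_sub_iter_le_of_plaqBound`** (any torus `P`, `SU(n)`, `j < m + K`) — the local sup lemma READ AS A DIFFERENCE: `dist1(U₂(∂p)) ≤ δ`, `‖U₁,e − U₂,e‖ ≤ ρ`, the four rows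
  at `η = (d−1)·2L^j·δ` ⟹ `‖Ū₁^{(j)}(b) − Ū₂^{(j)}(b)‖ ≤ 2(d+1)·L^j·ρ` at EVERY level-`j` bond (`‖X − V‖ = ‖(XV* − 1)V‖ = ‖pertVar‖`, unitarity); **`norm_iter_sub_iter_le_of_plaqBound_T3`**
  (T³, `SU(2)`, one number) `≤ 8·L^j·ρ`.
* §2 ★ **`norm_B27T_iter_sub_le_of_plaqBound`** (any torus, `SU(N)`) — §1 ∘ `norm_B27T_su_sub_le`: `‖B(Ū₁^{(j)})(y,c) − B(Ū₂^{(j)})(y,c)‖ ≤ (1−ρ′)⁻¹(2|c₋ − y|₁ + 2)·2(d+1)L^jρ`,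
  log-disc rows `hh₁`, `hh₂` displayed; ★ **`norm_B27T_iter_sub_le_canonLegDist_of_plaqBound`** (T³, `SU(2)`, anchor attaining the canonical leg distance, one number):
  `≤ 2(1−ρ′)⁻¹·(1 + canonLegDist F K j Y c)·(8·(F.L)^j·ρ)` — display (Lip♮) of `cfgDistCauchyΦ_of_fineComparison_scale` with `L_Φ = 16(1−ρ′)⁻¹`, NO gauge condition.
* §3 **`norm_holT_contourT_sub_one_le_of_plaqBound`** (any torus, `SU(N)`, any level-`j` field `V`): `dist1(V(∂p)) ≤ α` for every plaquette ⟹ `‖V(Γ_{y,c}) − 1‖ ≤ |c₋ − y|₁·α` for EVERY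
  anchor `y` and leg `c` (the torus (28) lemma with the box chosen as the coordinate hull of `{0, c₋ − y, c₊ − y}` — vacuous under a global bound);
  **`norm_holT_contourT_sub_one_le_canonLegDist_of_plaqBound`** (T³: `≤ canonLegDist F K j Y c·α`).
* §4 ★★ **`norm_B27T_iter_sub_le_canonLegDist_of_plaqSmall`** — (Lip♮) FOR THE NATURAL CHART MAPS AT TWO PLAQUETTE-REGULAR FINE FIELDS, GAUGE-INVARIANT DATA ONLY (T³, `SU(2)`, run `K`,
  height `n`, chart level `j < K − n`): `PlaqSmall (regThreshold F n K ε₀) Uᵢ` (`i = 1, 2`; = `RegPr`'s first conjunct), `10⁷L³ε₀ ≤ 1`, `‖U₁,e − U₂,e‖ ≤ ρ`, ONE number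
  `2·10¹⁴·L·(4L^j(ρ + 4L^j·regThreshold)) ≤ 1`, and the leg in print's regime `canonLegDist·α_j ≤ ρ′ < 1` with `α_j = (10800L+1)·L^{2j}·regThreshold F n K ε₀`
  (`IterPlaqSmallAllL.plaqSmall_iter_T3_allL`) ⟹ `‖B(Ū₁^{(j)})(y,c) − B(Ū₂^{(j)})(y,c)‖ ≤ 2(1−ρ′)⁻¹·(1 + canonLegDist F K j Y c)·(8·(F.L)^j·ρ)`.
HONEST FRAMING.  Compositions of ACCEPTED tree lemmas plus arithmetic; the Poincaré lemma, the two-field theorem and the (0.4)-descent plaquette smallness are the tree's.  What the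
I-11 row still needs beyond (Lip♮) is unchanged and NOT here: (Fine_b), the order-`b` two-cut-off consistency of the two runs' constrained minimisers in the bondwise sup distance
(located-UNPRINTED for the non-abelian d = 3 model; INPUT-LIST §5 item 3), and (B)∕(B′) at the pinned configuration family.  Nothing of [Balaban1985Averaging] ∕ [Balaban1985UV3] ∕
[Balaban1985Variational] ∕ [Balaban1987RG1] is asserted; no summit ∕ rung ∕ gap claim (YM₃ on T³ is rung R3, not the Clay problem).

References: T. Bałaban, CMP 98 (1985) 17–51 [Balaban1985Averaging] ((9)–(13) pp.18–19, p.24–25, Prop. 4 (134)–(135) p.38, Prop. 6 (164) p.43); CMP 102 (1985) 255–275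
[Balaban1985UV3] ((27)–(28) p.263, (44) p.267); CMP 102 (1985) 277–309 [Balaban1985Variational] ((2) p.278, (14)–(15) p.280, (146) p.301); CMP 109 (1987) 249–301
[Balaban1987RG1] ((0.4) p.253, (1.11)–(1.12) p.262).
-/

set_option autoImplicit false

noncomputable section

open scoped BigOperators Matrix.Norms.L2Operator
open Literature.MathematicalPhysics.QuantumFieldTheory.Balaban1983to89
open Literature.MathematicalPhysics.QuantumFieldTheory.Balaban1983to89.T3ContinuumYM3Torus
open Literature.MathematicalPhysics.QuantumFieldTheory.Balaban1983to89.T3RegularMinimiser (regThreshold)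
open Literature.MathematicalPhysics.QuantumFieldTheory.Balaban1983to89.B10Eq27TorusAxialLog
open Literature.MathematicalPhysics.QuantumFieldTheory.Balaban1983to89.B7Prop1Explicit (l1 e U1)
open Literature.MathematicalPhysics.QuantumFieldTheory.Balaban1983to89.B7Prop1Local (InBox PlaqIn)
open Literature.MathematicalPhysics.QuantumFieldTheory.Balaban1983to89.ExpMeanLog (expMeanLogSU deltaSU)
open Literature.MathematicalPhysics.QuantumFieldTheory.Balaban1983to89.BlockAveraging (blockAvg)
open Literature.MathematicalPhysics.QuantumFieldTheory.Balaban1983to89.BlockAveragingEMLLinearisedBackground (pertVar pertVar_eq)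
open Summit.QuantumFields.YangMills.Theorems

namespace Summit.QuantumFields.YangMills.Theorems.GlobalSlackKernelLeg

/-! ## §1 The local sup lemma read as a difference: `‖Ū₁^{(j)}(b) − Ū₂^{(j)}(b)‖ ≤ 2(d+1)L^jρ` from the plaquette bound and the bondwise sup -/

section LocalSup

variable {P : Params} {n : Type*} [Fintype n] [DecidableEq n] [Nonempty n]

/-- **THE `j`-FOLD AVERAGES OF TWO CLOSE FINE FIELDS ARE `2(d+1)L^jρ`-CLOSE AT EVERY LEVEL-`j` BOND — FROM THE PLAQUETTE BOUND AND THE BONDWISE SUP, NO GAUGE** (any torus `P`, `SU(n)`,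
`j < m + K`): if `dist1(U₂(∂p)) ≤ δ` for every finest plaquette, `‖U₁,e − U₂,e‖ ≤ ρ` on every finest bond, and the four smallness rows of the every-`L` two-field theorem hold at
level `j` with `η := (d−1)·2L^j·δ`, then `‖Ū₁^{(j)}(b) − Ū₂^{(j)}(b)‖ ≤ 2·((d+1)L^j·ρ)`.  (`Prop7FibreLevelSupLocalGauge.norm_pertVar_iter_le_of_plaqBound` read through
`‖X − V‖ = ‖(XV* − 1)·V‖ = ‖XV* − 1‖` for unitary `V`.) [cite: Balaban1985Averaging, (11)–(13) p.19, Prop. 4 (134)–(135) p.38, Prop. 6 (164) p.43; Balaban1987RG1, (1.11)–(1.12) p.262] -/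
theorem norm_iter_sub_iter_le_of_plaqBound {j : ℕ} (hj : j < P.m + P.K) (b : PBond P j)
    (U₁ U₂ : GaugeField P 0 (Matrix.specialUnitaryGroup n ℂ)) {ρ δ : ℝ} (hρ0 : 0 ≤ ρ) (hδ0 : 0 ≤ δ)
    (hU₂ : ∀ p : Plaq P 0, dist1 (GaugeField.plaqHol U₂ p) ≤ δ)
    (hρ : ∀ e : PBond P 0, ‖((U₁ e : Matrix.specialUnitaryGroup n ℂ) : Matrix n n ℂ) - ((U₂ e : Matrix.specialUnitaryGroup n ℂ) : Matrix n n ℂ)‖ ≤ ρ)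
    (hmδ : (((P.d : ℝ) + 1) * ((18 : ℝ) ^ P.d * (2 + ((P.d : ℝ) + 1) * (18 : ℝ) ^ P.d)) * (324 * (((P.d + 2) * P.L : ℕ) : ℝ) ^ 2) /
        ((P.L : ℝ) * ((P.L : ℝ) - 1))) * (((P.d : ℝ) + 1) * (P.L : ℝ) ^ j * (((P.d - 1 : ℕ) : ℝ) * (2 * (P.L : ℝ) ^ j) * δ)) ≤ 1)
    (h200 : 200 * (((P.d + 2) * P.L : ℕ) : ℝ) * ((((P.d : ℝ) + 1) * (P.L : ℝ) ^ j * ρ) + (((P.d : ℝ) + 1) * (P.L : ℝ) ^ j * (((P.d - 1 : ℕ) : ℝ) * (2 * (P.L : ℝ) ^ j) * δ))) ≤ 1)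
    (hm : (((P.d : ℝ) + 1) * ((18 : ℝ) ^ P.d * (2 + ((P.d : ℝ) + 1) * (18 : ℝ) ^ P.d)) * (5200 * (((P.d + 2) * P.L : ℕ) : ℝ) ^ 2) /
        ((P.L : ℝ) * ((P.L : ℝ) - 1))) * ((((P.d : ℝ) + 1) * (P.L : ℝ) ^ j * ρ) + (((P.d : ℝ) + 1) * (P.L : ℝ) ^ j * (((P.d - 1 : ℕ) : ℝ) * (2 * (P.L : ℝ) ^ j) * δ))) ≤ 1)
    (hNδ : 4 * (((P.d + 2) * P.L : ℕ) : ℝ) * ((((P.d : ℝ) + 1) * (P.L : ℝ) ^ j * ρ) + (((P.d : ℝ) + 1) * (P.L : ℝ) ^ j * (((P.d - 1 : ℕ) : ℝ) * (2 * (P.L : ℝ) ^ j) * δ))) < deltaSU n) :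
    ‖((Averaging.iter (fun i => blockAvg (P := P) (j := i) (expMeanLogSU (n := n))) j U₁ b : Matrix.specialUnitaryGroup n ℂ) : Matrix n n ℂ) -
        ((Averaging.iter (fun i => blockAvg (P := P) (j := i) (expMeanLogSU (n := n))) j U₂ b : Matrix.specialUnitaryGroup n ℂ) : Matrix n n ℂ)‖ ≤
      2 * (((P.d : ℝ) + 1) * (P.L : ℝ) ^ j * ρ) := by
  have h := Prop7FibreLevelSupLocalGauge.norm_pertVar_iter_le_of_plaqBound hj b U₁ U₂ hρ0 hδ0 hU₂ hρ hmδ h200 hm hNδ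
  rw [pertVar_eq] at h
  have hVu : ((Averaging.iter (fun i => blockAvg (P := P) (j := i) (expMeanLogSU (n := n))) j U₂ b : Matrix.specialUnitaryGroup n ℂ) : Matrix n n ℂ) ∈
      unitary (Matrix n n ℂ) := (Averaging.iter (fun i => blockAvg (P := P) (j := i) (expMeanLogSU (n := n))) j U₂ b).2.1
  have e : ((Averaging.iter (fun i => blockAvg (P := P) (j := i) (expMeanLogSU (n := n))) j U₁ b : Matrix.specialUnitaryGroup n ℂ) : Matrix n n ℂ) -
        ((Averaging.iter (fun i => blockAvg (P := P) (j := i) (expMeanLogSU (n := n))) j U₂ b : Matrix.specialUnitaryGroup n ℂ) : Matrix n n ℂ) =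
      (((Averaging.iter (fun i => blockAvg (P := P) (j := i) (expMeanLogSU (n := n))) j U₁ b : Matrix.specialUnitaryGroup n ℂ) : Matrix n n ℂ) *
          star ((Averaging.iter (fun i => blockAvg (P := P) (j := i) (expMeanLogSU (n := n))) j U₂ b : Matrix.specialUnitaryGroup n ℂ) : Matrix n n ℂ) - 1) *
        ((Averaging.iter (fun i => blockAvg (P := P) (j := i) (expMeanLogSU (n := n))) j U₂ b : Matrix.specialUnitaryGroup n ℂ) : Matrix n n ℂ) := by
    rw [sub_mul, one_mul, mul_assoc, Unitary.star_mul_self_of_mem hVu, mul_one]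
  rw [e, CStarRing.norm_mul_mem_unitary _ hVu]
  exact h

variable {F : T3Family}

/-- **The same on T³ ∕ `SU(2)` with the rows GONE**: `j < m + K`; `dist1(U₂(∂p)) ≤ δ`, `‖U₁,e − U₂,e‖ ≤ ρ`, ONE number `2·10¹⁴·L·(4L^j(ρ + 2·2L^j·δ)) ≤ 1`; then
`‖Ū₁^{(j)}(b) − Ū₂^{(j)}(b)‖ ≤ 8·L^j·ρ` (`Prop7FibreLevelSupRowsT3.norm_pertVar_iter_le_of_plaqBound_T3`, `d = 3`).
[cite: Balaban1985Averaging, Prop. 4 (134)–(135) p.38, Prop. 6 (164) p.43; Balaban1987RG1, (1.11)–(1.12) p.262] -/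
theorem norm_iter_sub_iter_le_of_plaqBound_T3 {K j : ℕ} (hj : j < (F.P K).m + (F.P K).K) (b : PBond (F.P K) j)
    (U₁ U₂ : GaugeField (F.P K) 0 (Matrix.specialUnitaryGroup (Fin 2) ℂ)) {ρ δ : ℝ} (hρ0 : 0 ≤ ρ) (hδ0 : 0 ≤ δ)
    (hU₂ : ∀ p : Plaq (F.P K) 0, dist1 (GaugeField.plaqHol U₂ p) ≤ δ)
    (hρ : ∀ e : PBond (F.P K) 0, ‖((U₁ e : Matrix.specialUnitaryGroup (Fin 2) ℂ) : Matrix (Fin 2) (Fin 2) ℂ) - ((U₂ e : Matrix.specialUnitaryGroup (Fin 2) ℂ) : Matrix (Fin 2) (Fin 2) ℂ)‖ ≤ ρ)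
    (h : 2 * 10 ^ 14 * (F.L : ℝ) * (4 * (F.L : ℝ) ^ j * (ρ + 2 * (2 * (F.L : ℝ) ^ j) * δ)) ≤ 1) :
    ‖((Averaging.iter (fun i => blockAvg (P := F.P K) (j := i) (expMeanLogSU (n := Fin 2))) j U₁ b : Matrix.specialUnitaryGroup (Fin 2) ℂ) : Matrix (Fin 2) (Fin 2) ℂ) -
        ((Averaging.iter (fun i => blockAvg (P := F.P K) (j := i) (expMeanLogSU (n := Fin 2))) j U₂ b : Matrix.specialUnitaryGroup (Fin 2) ℂ) : Matrix (Fin 2) (Fin 2) ℂ)‖ ≤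
      8 * (F.L : ℝ) ^ j * ρ := by
  have h' := Prop7FibreLevelSupRowsT3.norm_pertVar_iter_le_of_plaqBound_T3 F K hj b U₁ U₂ hρ0 hδ0 hU₂ hρ h
  rw [pertVar_eq] at h'
  have hVu : ((Averaging.iter (fun i => blockAvg (P := F.P K) (j := i) (expMeanLogSU (n := Fin 2))) j U₂ b : Matrix.specialUnitaryGroup (Fin 2) ℂ) : Matrix (Fin 2) (Fin 2) ℂ) ∈
      unitary (Matrix (Fin 2) (Fin 2) ℂ) := (Averaging.iter (fun i => blockAvg (P := F.P K) (j := i) (expMeanLogSU (n := Fin 2))) j U₂ b).2.1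
  have e : ((Averaging.iter (fun i => blockAvg (P := F.P K) (j := i) (expMeanLogSU (n := Fin 2))) j U₁ b : Matrix.specialUnitaryGroup (Fin 2) ℂ) : Matrix (Fin 2) (Fin 2) ℂ) -
        ((Averaging.iter (fun i => blockAvg (P := F.P K) (j := i) (expMeanLogSU (n := Fin 2))) j U₂ b : Matrix.specialUnitaryGroup (Fin 2) ℂ) : Matrix (Fin 2) (Fin 2) ℂ) =
      (((Averaging.iter (fun i => blockAvg (P := F.P K) (j := i) (expMeanLogSU (n := Fin 2))) j U₁ b : Matrix.specialUnitaryGroup (Fin 2) ℂ) : Matrix (Fin 2) (Fin 2) ℂ) *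
          star ((Averaging.iter (fun i => blockAvg (P := F.P K) (j := i) (expMeanLogSU (n := Fin 2))) j U₂ b : Matrix.specialUnitaryGroup (Fin 2) ℂ) : Matrix (Fin 2) (Fin 2) ℂ) - 1) *
        ((Averaging.iter (fun i => blockAvg (P := F.P K) (j := i) (expMeanLogSU (n := Fin 2))) j U₂ b : Matrix.specialUnitaryGroup (Fin 2) ℂ) : Matrix (Fin 2) (Fin 2) ℂ) := by
    rw [sub_mul, one_mul, mul_assoc, Unitary.star_mul_self_of_mem hVu, mul_one]
  rw [e, CStarRing.norm_mul_mem_unitary _ hVu]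
  have hd : (((F.P K).d : ℝ) + 1) = 4 := by rw [T3Family.P_d]; norm_num
  have hLK : ((F.P K).L : ℝ) = (F.L : ℝ) := rfl
  rw [hd, hLK] at h'
  calc _ ≤ 2 * (4 * (F.L : ℝ) ^ j * ρ) := h'
    _ = 8 * (F.L : ℝ) ^ j * ρ := by ring

end LocalSup

/-! ## §2 (Lip♮) for the natural chart maps from the plaquette bound and the bondwise sup -/

section Lip

variable {P : Params} {N : ℕ} [NeZero N]

/-- ★ **THE (27) LOOP VARIABLES OF THE `j`-FOLD AVERAGES OF TWO CLOSE FINE FIELDS DIFFER BY `O((1 + |c₋ − y|₁)·L^j·ρ)` — FROM THE PLAQUETTE BOUND AND THE BONDWISE SUP, NO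
GAUGE** (any torus `P`, `SU(N)`, `j < m + K`): `dist1(U₂(∂p)) ≤ δ` on every finest plaquette, `‖U₁,e − U₂,e‖ ≤ ρ` on every finest bond, the four smallness rows at level `j` with
`η := (d−1)·2L^j·δ`, and at `(y, c)` both contour holonomies in the disc `‖· − 1‖ ≤ ρ′ < 1` of the logarithm; then
`‖B(Ū₁^{(j)})(y,c) − B(Ū₂^{(j)})(y,c)‖ ≤ (1 − ρ′)⁻¹·(2|c₋ − y|₁ + 2)·(2(d+1)·L^j·ρ)` (§1 ∘ `norm_B27T_su_sub_le`) — the local twin of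
`norm_B27T_iter_sub_le_of_twoField`, whose flat-gauge hypothesis `‖U₂,b − 1‖ ≤ δ` is replaced by the gauge-invariant plaquette bound.
[cite: Balaban1985Averaging, Prop. 4 (134)–(135) p.38, Prop. 6 (164) p.43; Balaban1985UV3, (27)-(28) p.263, (44) p.267; Balaban1987RG1, (1.11)–(1.12) p.262] -/
theorem norm_B27T_iter_sub_le_of_plaqBound (U₁ U₂ : GaugeField P 0 (Matrix.specialUnitaryGroup (Fin N) ℂ)) {ρ δ : ℝ} (hρ0 : 0 ≤ ρ) (hδ0 : 0 ≤ δ)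
    (hU₂ : ∀ p : Plaq P 0, dist1 (GaugeField.plaqHol U₂ p) ≤ δ)
    (hρ : ∀ e : PBond P 0, ‖((U₁ e : Matrix.specialUnitaryGroup (Fin N) ℂ) : Matrix (Fin N) (Fin N) ℂ) - ((U₂ e : Matrix.specialUnitaryGroup (Fin N) ℂ) : Matrix (Fin N) (Fin N) ℂ)‖ ≤ ρ)
    {j : ℕ} (hj : j < P.m + P.K)
    (hmδ : (((P.d : ℝ) + 1) * ((18 : ℝ) ^ P.d * (2 + ((P.d : ℝ) + 1) * (18 : ℝ) ^ P.d)) * (324 * (((P.d + 2) * P.L : ℕ) : ℝ) ^ 2) /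
        ((P.L : ℝ) * ((P.L : ℝ) - 1))) * (((P.d : ℝ) + 1) * (P.L : ℝ) ^ j * (((P.d - 1 : ℕ) : ℝ) * (2 * (P.L : ℝ) ^ j) * δ)) ≤ 1)
    (h200 : 200 * (((P.d + 2) * P.L : ℕ) : ℝ) * ((((P.d : ℝ) + 1) * (P.L : ℝ) ^ j * ρ) + (((P.d : ℝ) + 1) * (P.L : ℝ) ^ j * (((P.d - 1 : ℕ) : ℝ) * (2 * (P.L : ℝ) ^ j) * δ))) ≤ 1)
    (hm : (((P.d : ℝ) + 1) * ((18 : ℝ) ^ P.d * (2 + ((P.d : ℝ) + 1) * (18 : ℝ) ^ P.d)) * (5200 * (((P.d + 2) * P.L : ℕ) : ℝ) ^ 2) /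
        ((P.L : ℝ) * ((P.L : ℝ) - 1))) * ((((P.d : ℝ) + 1) * (P.L : ℝ) ^ j * ρ) + (((P.d : ℝ) + 1) * (P.L : ℝ) ^ j * (((P.d - 1 : ℕ) : ℝ) * (2 * (P.L : ℝ) ^ j) * δ))) ≤ 1)
    (hNδ : 4 * (((P.d + 2) * P.L : ℕ) : ℝ) * ((((P.d : ℝ) + 1) * (P.L : ℝ) ^ j * ρ) + (((P.d : ℝ) + 1) * (P.L : ℝ) ^ j * (((P.d - 1 : ℕ) : ℝ) * (2 * (P.L : ℝ) ^ j) * δ))) < deltaSU (Fin N))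
    (y : Site P j) (c : PBond P j) {ρ' : ℝ} (hρ' : ρ' < 1)
    (hh₁ : ‖((holT (unitsField (toUField (Averaging.iter (fun i => blockAvg (P := P) (j := i) (expMeanLogSU (n := Fin N))) j U₁))) y (contourT y c) :
        (Matrix (Fin N) (Fin N) ℂ)ˣ) : Matrix (Fin N) (Fin N) ℂ) - 1‖ ≤ ρ')
    (hh₂ : ‖((holT (unitsField (toUField (Averaging.iter (fun i => blockAvg (P := P) (j := i) (expMeanLogSU (n := Fin N))) j U₂))) y (contourT y c) :
        (Matrix (Fin N) (Fin N) ℂ)ˣ) : Matrix (Fin N) (Fin N) ℂ) - 1‖ ≤ ρ') :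
    ‖B27T (unitsField (toUField (Averaging.iter (fun i => blockAvg (P := P) (j := i) (expMeanLogSU (n := Fin N))) j U₁))) y c -
        B27T (unitsField (toUField (Averaging.iter (fun i => blockAvg (P := P) (j := i) (expMeanLogSU (n := Fin N))) j U₂))) y c‖ ≤
      (1 - ρ')⁻¹ * (2 * l1 (rel y c.src) + 2) * (2 * (((P.d : ℝ) + 1) * (P.L : ℝ) ^ j * ρ)) := by
  have hε : ∀ b : PBond P j,
      ‖((Averaging.iter (fun i => blockAvg (P := P) (j := i) (expMeanLogSU (n := Fin N))) j U₁ b : Matrix.specialUnitaryGroup (Fin N) ℂ) : Matrix (Fin N) (Fin N) ℂ) -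
          ((Averaging.iter (fun i => blockAvg (P := P) (j := i) (expMeanLogSU (n := Fin N))) j U₂ b : Matrix.specialUnitaryGroup (Fin N) ℂ) : Matrix (Fin N) (Fin N) ℂ)‖ ≤
        2 * (((P.d : ℝ) + 1) * (P.L : ℝ) ^ j * ρ) := fun b => norm_iter_sub_iter_le_of_plaqBound hj b U₁ U₂ hρ0 hδ0 hU₂ hρ hmδ h200 hm hNδ
  exact norm_B27T_su_sub_le _ _ (by positivity) hε y c hρ' hh₁ hh₂

variable {F : T3Family}

/-- ★ **(Lip♮) FOR THE NATURAL CHART MAPS ON T³, IN THE ROW'S CURRENCY, FROM GAUGE-INVARIANT DATA** (`SU(2)`, `d = 3`, `j < m + K`, anchor attaining the canonical leg distance):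
`dist1(U₂(∂p)) ≤ δ`, `‖U₁,e − U₂,e‖ ≤ ρ`, ONE number `2·10¹⁴·L·(4L^j(ρ + 2·2L^j·δ)) ≤ 1`, the two log-disc rows at `(y, c)`; then
`‖B(Ū₁^{(j)})(y,c) − B(Ū₂^{(j)})(y,c)‖ ≤ 2(1 − ρ′)⁻¹·(1 + canonLegDist F K j Y c)·(8·(F.L)^j·ρ)` — display (Lip♮) of `cfgDistCauchyΦ_of_fineComparison_scale` with `L_Φ = 16(1−ρ′)⁻¹` and
`δ := ρ` the bondwise sup distance of the fine pair, WITHOUT the global flat gauge of `norm_B27T_iter_sub_le_canonLegDist_of_twoField`.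
[cite: Balaban1985Averaging, Prop. 4 (134)–(135) p.38, Prop. 6 (164) p.43; Balaban1985UV3, (27)-(28) p.263, (44) p.267; Balaban1987RG1, (1.11)–(1.12) p.262] -/
theorem norm_B27T_iter_sub_le_canonLegDist_of_plaqBound {K : ℕ} (Y : Set (Site (F.P K) 0)) {j : ℕ} (c : PBond (F.P K) j) {y : Site (F.P K) j}
    (hy : canonLegDist F K j Y c = pdist c.src y)
    (U₁ U₂ : GaugeField (F.P K) 0 (Matrix.specialUnitaryGroup (Fin 2) ℂ)) {ρ δ : ℝ} (hρ0 : 0 ≤ ρ) (hδ0 : 0 ≤ δ)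
    (hU₂ : ∀ p : Plaq (F.P K) 0, dist1 (GaugeField.plaqHol U₂ p) ≤ δ)
    (hρ : ∀ e : PBond (F.P K) 0, ‖((U₁ e : Matrix.specialUnitaryGroup (Fin 2) ℂ) : Matrix (Fin 2) (Fin 2) ℂ) - ((U₂ e : Matrix.specialUnitaryGroup (Fin 2) ℂ) : Matrix (Fin 2) (Fin 2) ℂ)‖ ≤ ρ)
    (hj : j < (F.P K).m + (F.P K).K)
    (h : 2 * 10 ^ 14 * (F.L : ℝ) * (4 * (F.L : ℝ) ^ j * (ρ + 2 * (2 * (F.L : ℝ) ^ j) * δ)) ≤ 1)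
    {ρ' : ℝ} (hρ' : ρ' < 1)
    (hh₁ : ‖((holT (unitsField (toUField (Averaging.iter (fun i => blockAvg (P := F.P K) (j := i) (expMeanLogSU (n := Fin 2))) j U₁))) y (contourT y c) :
        (Matrix (Fin 2) (Fin 2) ℂ)ˣ) : Matrix (Fin 2) (Fin 2) ℂ) - 1‖ ≤ ρ')
    (hh₂ : ‖((holT (unitsField (toUField (Averaging.iter (fun i => blockAvg (P := F.P K) (j := i) (expMeanLogSU (n := Fin 2))) j U₂))) y (contourT y c) :
        (Matrix (Fin 2) (Fin 2) ℂ)ˣ) : Matrix (Fin 2) (Fin 2) ℂ) - 1‖ ≤ ρ') :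
    ‖B27T (unitsField (toUField (Averaging.iter (fun i => blockAvg (P := F.P K) (j := i) (expMeanLogSU (n := Fin 2))) j U₁))) y c -
        B27T (unitsField (toUField (Averaging.iter (fun i => blockAvg (P := F.P K) (j := i) (expMeanLogSU (n := Fin 2))) j U₂))) y c‖ ≤
      2 * (1 - ρ')⁻¹ * (1 + canonLegDist F K j Y c) * (8 * (F.L : ℝ) ^ j * ρ) := by
  have hε : ∀ b : PBond (F.P K) j,
      ‖((Averaging.iter (fun i => blockAvg (P := F.P K) (j := i) (expMeanLogSU (n := Fin 2))) j U₁ b : Matrix.specialUnitaryGroup (Fin 2) ℂ) : Matrix (Fin 2) (Fin 2) ℂ) -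
          ((Averaging.iter (fun i => blockAvg (P := F.P K) (j := i) (expMeanLogSU (n := Fin 2))) j U₂ b : Matrix.specialUnitaryGroup (Fin 2) ℂ) : Matrix (Fin 2) (Fin 2) ℂ)‖ ≤
        8 * (F.L : ℝ) ^ j * ρ := fun b => norm_iter_sub_iter_le_of_plaqBound_T3 hj b U₁ U₂ hρ0 hδ0 hU₂ hρ h
  exact norm_B27T_su_sub_le_canonLegDist Y c hy _ _ (by positivity) hε hρ' hh₁ hh₂

end Lip

/-! ## §3 The log-disc rows from plaquette smallness of a level-`j` field: the torus (28) lemma under a global bound -/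

section Disc

variable {P : Params} {N : ℕ} [NeZero N]

/-- **THE CONTOUR HOLONOMY OF (27) IS WITHIN `|c₋ − y|₁·α` OF `1` AT EVERY ANCHOR AND LEG when every plaquette variable of the level-`j` `SU(N)` field `V` satisfies `dist1(V(∂p)) ≤ α`**
(any torus; `B10Eq27TorusAxialLog.norm_holT_contourT_sub_one_le` with the box taken as the coordinate hull of `{0, c₋ − y, c₊ − y}`, whose conditions are then vacuous; `h13_unitsField`
turns the cell's `dist1` bound into the plaquette-word hypothesis for both orientations). [cite: Balaban1985UV3, (27)-(28) p.263; Balaban1985Averaging, (11)–(13) p.19, p.24–25] -/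
theorem norm_holT_contourT_sub_one_le_of_plaqBound {j : ℕ} (V : GaugeField P j (Matrix.specialUnitaryGroup (Fin N) ℂ)) {α : ℝ} (hα : 0 ≤ α)
    (hV : ∀ p : Plaq P j, dist1 (GaugeField.plaqHol V p) ≤ α) (y : Site P j) (c : PBond P j) :
    ‖((holT (unitsField (toUField V)) y (contourT y c) : (Matrix (Fin N) (Fin N) ℂ)ˣ) : Matrix (Fin N) (Fin N) ℂ) - 1‖ ≤ l1 (rel y c.src) * α := by
  letI : CStarAlgebra (Matrix (Fin N) (Fin N) ℂ) := B10Eq29TubeLine.cstarAlgebraMatrix N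
  -- the box: coordinate hull of `0`, `c₋ − y`, `c₊ − y`
  let lo : B7Prop1Explicit.Site P.d := fun i => min (min 0 (rel y c.src i)) ((rel y c.src + e c.dir) i)
  let hi : B7Prop1Explicit.Site P.d := fun i => max (max 0 (rel y c.src i)) ((rel y c.src + e c.dir) i)
  have hlohi : ∀ i, lo i ≤ hi i := fun i =>
    ((min_le_left _ _).trans (min_le_left _ _)).trans ((le_max_left _ _).trans' (le_max_left _ _))
  have h0 : InBox lo hi 0 := fun i => ⟨(min_le_left _ _).trans (min_le_left _ _), (le_max_left _ _).trans' (le_max_left _ _)⟩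
  have hc : InBox lo hi (rel y c.src) := fun i => ⟨(min_le_left _ _).trans (min_le_right _ _), (le_max_left _ _).trans' (le_max_right _ _)⟩
  have hce : InBox lo hi (rel y c.src + e c.dir) := fun i => ⟨min_le_right _ _, le_max_right _ _⟩
  have hU1 : ∀ b, unitsField (toUField V) b ∈ U1 (Matrix (Fin N) (Fin N) ℂ) := U1_of_unitaryUnits (unitsField_mem_unitaryUnits (toUField V))
  have h13 := h13_unitsField (lo := lo) (hi := hi) (toUField V) y (α := α) (fun z κ μ hκμ _ => by rw [dist1_plaqHol_toUField]; exact hV _)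
  exact norm_holT_contourT_sub_one_le hlohi _ hU1 y h13 hα h0 c hc hce

variable {F : T3Family}

/-- **The same on T³ in the row's currency**: at an anchor `y` attaining the canonical leg distance, `‖V(Γ_{y,c}) − 1‖ ≤ canonLegDist F K j Y c·α` (`|c₋ − y|₁ = pdist c₋ y`,
`…GlobalSlackLegCfgDistT3.cast_l1_rel_eq_pdist`). [cite: Balaban1985UV3, (27)-(28) p.263, (44) p.267] -/
theorem norm_holT_contourT_sub_one_le_canonLegDist_of_plaqBound {K j : ℕ} (Y : Set (Site (F.P K) 0)) (c : PBond (F.P K) j) {y : Site (F.P K) j}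
    (hy : canonLegDist F K j Y c = pdist c.src y) (V : GaugeField (F.P K) j (Matrix.specialUnitaryGroup (Fin 2) ℂ)) {α : ℝ} (hα : 0 ≤ α)
    (hV : ∀ p : Plaq (F.P K) j, dist1 (GaugeField.plaqHol V p) ≤ α) :
    ‖((holT (unitsField (toUField V)) y (contourT y c) : (Matrix (Fin 2) (Fin 2) ℂ)ˣ) : Matrix (Fin 2) (Fin 2) ℂ) - 1‖ ≤ canonLegDist F K j Y c * α := by
  have h := norm_holT_contourT_sub_one_le_of_plaqBound V hα hV y c
  rwa [cast_l1_rel_eq_pdist, ← hy] at h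

end Disc

/-! ## §4 ★★ (Lip♮) for the natural chart maps at two plaquette-regular fine fields: gauge-invariant data only -/

section Regular

variable {F : T3Family}

/-- ★★ **(Lip♮) FOR THE NATURAL CHART MAPS AT TWO PLAQUETTE-REGULAR, BONDWISE-CLOSE FINE FIELDS — GAUGE-INVARIANT DATA ONLY** (T³, `SU(2)`; run `K`, height `n`, chart level
`j < K − n`; anchor `y` attaining the canonical leg distance of the leg `c`).  HYPOTHESES: both fine fields plaquette-regular, `PlaqSmall (regThreshold F n K ε₀) Uᵢ`
(`= ε₀·L^{−2(K−n)}`; the first conjunct of the cell's `RegPr`), `0 < ε₀`, `10⁷·L³·ε₀ ≤ 1`; bondwise `‖U₁,e − U₂,e‖ ≤ ρ`; ONE number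
`2·10¹⁴·L·(4L^j(ρ + 2·2L^j·regThreshold)) ≤ 1`; and the leg inside print's regime: `canonLegDist F K j Y c·α_j ≤ ρ′ < 1` with `α_j := (10800L + 1)·(L^{2j}·regThreshold F n K ε₀)` the
plaquette smallness of the `j`-fold averages (`IterPlaqSmallAllL.plaqSmall_iter_T3_allL`).  CONCLUSION:
`‖B(Ū₁^{(j)})(y,c) − B(Ū₂^{(j)})(y,c)‖ ≤ 2(1 − ρ′)⁻¹·(1 + canonLegDist F K j Y c)·(8·(F.L)^j·ρ)` — display (Lip♮) of `cfgDistCauchyΦ_of_fineComparison_scale` (`L_Φ = 16(1−ρ′)⁻¹`,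
`δ := ρ`), the log-disc rows now READ from §3 at the two averages.  Nothing about which fine fields the row feeds (the two runs' constrained minimisers) or about their distance `ρ`
((Fine_b), located-unprinted) is asserted here.
[cite: Balaban1985Averaging, Prop. 4 (134)–(135) p.38, Prop. 6 (164) p.43; Balaban1985UV3, (27)-(28) p.263, (44) p.267; Balaban1985Variational, (2) p.278, (146) p.301; Balaban1987RG1, (1.11)–(1.12) p.262] -/
theorem norm_B27T_iter_sub_le_canonLegDist_of_plaqSmall {n K : ℕ} (Y : Set (Site (F.P K) 0)) {j : ℕ} (c : PBond (F.P K) j) {y : Site (F.P K) j}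
    (hy : canonLegDist F K j Y c = pdist c.src y)
    (U₁ U₂ : GaugeField (F.P K) 0 (Matrix.specialUnitaryGroup (Fin 2) ℂ)) {ε₀ ρ : ℝ} (hε₀ : 0 < ε₀) (hε : 10 ^ 7 * (F.L : ℝ) ^ 3 * ε₀ ≤ 1) (hρ0 : 0 ≤ ρ)
    (hU₁ : PlaqSmall (regThreshold F n K ε₀) U₁) (hU₂ : PlaqSmall (regThreshold F n K ε₀) U₂)
    (hρ : ∀ e : PBond (F.P K) 0, ‖((U₁ e : Matrix.specialUnitaryGroup (Fin 2) ℂ) : Matrix (Fin 2) (Fin 2) ℂ) - ((U₂ e : Matrix.specialUnitaryGroup (Fin 2) ℂ) : Matrix (Fin 2) (Fin 2) ℂ)‖ ≤ ρ)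
    (hj : j < K - n)
    (h : 2 * 10 ^ 14 * (F.L : ℝ) * (4 * (F.L : ℝ) ^ j * (ρ + 2 * (2 * (F.L : ℝ) ^ j) * regThreshold F n K ε₀)) ≤ 1)
    {ρ' : ℝ} (hρ' : ρ' < 1)
    (hleg : canonLegDist F K j Y c * ((10800 * (F.L : ℝ) + 1) * ((F.L : ℝ) ^ (2 * j) * regThreshold F n K ε₀)) ≤ ρ') :
    ‖B27T (unitsField (toUField (Averaging.iter (fun i => blockAvg (P := F.P K) (j := i) (expMeanLogSU (n := Fin 2))) j U₁))) y c -
        B27T (unitsField (toUField (Averaging.iter (fun i => blockAvg (P := F.P K) (j := i) (expMeanLogSU (n := Fin 2))) j U₂))) y c‖ ≤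
      2 * (1 - ρ')⁻¹ * (1 + canonLegDist F K j Y c) * (8 * (F.L : ℝ) ^ j * ρ) := by
  have hL0 : (0 : ℝ) < F.L := by exact_mod_cast F.hL.2.le
  have hreg0 : 0 ≤ regThreshold F n K ε₀ := by unfold regThreshold; positivity
  have hjmK : j < (F.P K).m + (F.P K).K := by show j < F.m + K; omega
  have hα : 0 ≤ (10800 * (F.L : ℝ) + 1) * ((F.L : ℝ) ^ (2 * j) * regThreshold F n K ε₀) := by positivity
  have hs₁ := IterPlaqSmallAllL.plaqSmall_iter_T3_allL F n K hε₀ hε U₁ hU₁ j hj.le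
  have hs₂ := IterPlaqSmallAllL.plaqSmall_iter_T3_allL F n K hε₀ hε U₂ hU₂ j hj.le
  have hh₁ := (norm_holT_contourT_sub_one_le_canonLegDist_of_plaqBound Y c hy _ hα (fun p => (hs₁ p).le)).trans hleg
  have hh₂ := (norm_holT_contourT_sub_one_le_canonLegDist_of_plaqBound Y c hy _ hα (fun p => (hs₂ p).le)).trans hleg
  exact norm_B27T_iter_sub_le_canonLegDist_of_plaqBound Y c hy U₁ U₂ hρ0 hreg0 (fun p => (hU₂ p).le) hρ hjmK h hρ' hh₁ hh₂

end Regular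

end Summit.QuantumFields.YangMills.Theorems.GlobalSlackKernelLeg

end
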